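import Summits.Ventures.CertifiedManyBodySolver.Observables.TIGroundStatePairLROCeilingAssembly
import Literature.MathematicalPhysics.QuantumLattice.InfVolFermionStateBoxStatePairField

/-!
# The pair-LRO CEILING of translation-invariant sourced ground states — DISCHARGED
# (`TIGroundStatePairLROCeiling` holds; the sharp infinite-volume Koma–Tasaki identity is unconditional)

Cell `hubbard-cq` (venture `CertifiedManyBodySolver`; transplant-1 DICTIONARY §12 proof chain COMPLETE:
(α) hubbard-cq-p1 `ApproximatingHamiltonianGroundEnergy`, (β) hubbard-cq-p3 `SourcedTorusTTPrime*`,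
(γ) hubbard-cq-p4 `DWaveSourcePhaseRotation`, (δ) hubbard-cq-p1 `DWaveSourceApproxSourceLowerBound`,
(ε) hubbard-cq-p4 `InfVolFermionStateBoxState{,PairField}`, (ζ)(η) hubbard-cq-p3
`TIGroundStatePairLROCeilingAssembly`; statement and conditional corollaries typed by hubbard-cq-p5 from
transplant-1's `TransplantSketch4.lean` in `Literature/…/TIGroundStatePairLROCeiling.lean`).

* `boxTorusBound` — step (ε) in the interface of `tiGroundStatePairLROCeiling_of_boxTorusBound`: for every
  `h₀ ≥ 0`, every translation-invariant ground state `ω` of `Ψ_{h₀}`, `L ≥ max 3 L_inj`, `g ≥ 0`: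
  `E₀(A_L(h₀) − (g/L²)Δ_dᴴΔ_d) ≤ L²·E(h₀) + 4C_src·L − g·L²·boxLRO_L(ω) + 16gK_d²·L` (hubbard-cq-p4's
  `IsMeanEnergyMinimiser.groundEnergy_dWaveSourceTorusTT'_sub_smul_le` at `c = g/L²`);
* **`tiGroundStatePairLROCeiling_holds : TIGroundStatePairLROCeiling t' U μ`** — for every `h ≥ 0`, every
  translation-invariant ground state `ω` of the pair-sourced `t–t'` Hubbard interaction `Ψ_h` and every
  `ε > 0`, eventually in `N`: `Re N⁻⁴ Σ_{x,y∈[0,N)²} ω(P_x^d⋆P_y^d) ≤ (∂⁺E(h)/2)² + ε`;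
* UNCONDITIONAL COROLLARIES (the tree's `_of_ceiling` theorems fed): `zeroFieldPairLROCeiling_holds`
  (every TI ground state of the grand-canonical `t–t'` Hubbard interaction has asymptotic box pair LRO
  `≤ (m⋆)²`), **`sharpKomaTasaki`** (`max_{TI GS} limsup_N boxLRO_N = (m⋆)²`, attained by a gauge-invariant
  ground state: response ⇔ LRO with EQUALITY in the infinite-volume translation-invariant class), `clustering`
  (at `h > 0` off the kinks of `E`: `ω(P₀^d) = −E'(h)/2 ∈ ℝ` and `boxLRO_N(ω) → (E'(h)/2)²`).

HONEST SCOPE / WHAT THIS IS NOT: T5-class dictionary theorems about INFINITE-VOLUME translation-invariant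
ground states of the `t–t'` Hubbard model (every `t'`, `U`, `μ`); the DIRECTION is the known one (LRO ⇒
response, Koma–Tasaki 1993 Thm 7.3 / KHL), the setting (arbitrary TI infinite-volume ground states, equality)
is the variant; NO bearing on TORUS ground states (census (24)/(44): the torus half of the converse is
[U] ∧ [BN7]); no CQ bit; nothing here FLOORS `d`-wave order; not a superconductivity verdict. Everything
PROVED; no definition, no named fact; zero compute.

References: T. Koma, H. Tasaki, Commun. Math. Phys. 158 (1993) 191, Theorem 7.3; T. Kennedy, E. H. Lieb,
B. S. Shastry, J. Stat. Phys. 53 (1988) 1019; N. N. Bogolyubov Jr. et al., Russ. Math. Surveys 39:6 (1984);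
J.-B. Bru, W. de Siqueira Pedra, Mem. AMS 224 (2013), Appendix, Theorem 107; R. B. Griffiths, Phys. Rev. 152
(1966) 240, §II; H. Tasaki, J. Stat. Phys. 174 (2019) 735, Thms 3.3–3.4.
-/

noncomputable section

namespace Summit.Ventures.CertifiedManyBodySolver.Observables.SourcedTorusAHM

open Matrix Finset Filter Topology Set Literature.MathematicalPhysics.QuantumLattice
open Literature.Probability.LatticeModels
open scoped ComplexOrder

/-- **Step (ε) in the assembly's interface** (hubbard-cq-p4's trial-state inequality
`IsMeanEnergyMinimiser.groundEnergy_dWaveSourceTorusTT'_sub_smul_le` at `c = g/L²`): for every `h₀ ≥ 0`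
and every translation-invariant ground state `ω` of `Ψ_{h₀}` there are `c₁ = 4C_src`, `c₂ = 16K_d²` and
`L₁ = max 3 L_inj` with `E₀(A_L(h₀) − (g/L²)Δ_dᴴΔ_d) ≤ L²·E(h₀) + c₁L − g·L²·boxLRO_L(ω) + g·c₂L` for all
`L ≥ L₁`, `g ≥ 0`. Bogoliubov Jr. (1966) Thm 1 (trial-state half). -/
theorem boxTorusBound (tp U μ : ℝ) :
    ∀ ⦃h₀ : ℝ⦄, 0 ≤ h₀ → ∀ ⦃ω : InfVolFermionState 2⦄,
      ω.IsMeanEnergyMinimiser (hubbardTTPrimeSourcedInteraction 1 tp U μ dWaveFormFactor h₀) 1 →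
      ∃ c₁ c₂ : ℝ, ∃ L₁ : ℕ, ∀ (L : ℕ) [NeZero L], L₁ ≤ L → ∀ g : ℝ, 0 ≤ g →
        (dWaveSourceTorusTT' L tp U μ h₀ - ((g / (L : ℝ) ^ 2 : ℝ) : ℂ) •
            ((pairField dWaveFormFactor L)ᴴ * pairField dWaveFormFactor L)).groundEnergy ≤
          (L : ℝ) ^ 2 * dWaveSourceEnergyDensityTT' tp U μ h₀ + c₁ * L -
            g * (L : ℝ) ^ 2 * (((L : ℂ) ^ 4)⁻¹ * ∑ x ∈ halfOpenBox 2 L, ∑ y ∈ halfOpenBox 2 L,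
              ω.dWavePairCorr x y).re + g * c₂ * L := by
  intro h₀ _ ω hω
  obtain ⟨Li, hLi⟩ := exists_forall_le_injOn_proj (d := 2) dWaveSourceWindow
  refine ⟨4 * (-(-dWaveSourceEnergyObsTT' tp U μ h₀).groundEnergy -
      (dWaveSourceEnergyObsTT' tp U μ h₀).groundEnergy),
    16 * (2 * ∑ e ∈ insert (0 : Site 2) unitSteps, |dWaveFormFactor e / Real.sqrt 2|) ^ 2,
    max 3 Li, fun L _ hL g hg => ?_⟩
  have h3 : 3 ≤ L := le_trans (le_max_left _ _) hL
  have hInj := hLi L (le_trans (le_max_right _ _) hL)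
  have hL0 : (0 : ℝ) < (L : ℝ) := by exact_mod_cast (show 0 < L by omega)
  have hLne : (L : ℝ) ≠ 0 := hL0.ne'
  have key := hω.groundEnergy_dWaveSourceTorusTT'_sub_smul_le (L := L) h3 hInj (c := g / (L : ℝ) ^ 2)
    (by positivity)
  have e : (L : ℝ) ^ 2 * dWaveSourceEnergyDensityTT' tp U μ h₀ +
        4 * L * (-(-dWaveSourceEnergyObsTT' tp U μ h₀).groundEnergy -
          (dWaveSourceEnergyObsTT' tp U μ h₀).groundEnergy) -
        g / (L : ℝ) ^ 2 * ((L : ℝ) ^ 4 * (((L : ℂ) ^ 4)⁻¹ * ∑ x ∈ halfOpenBox 2 L,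
          ∑ y ∈ halfOpenBox 2 L, ω.dWavePairCorr x y).re -
          16 * (2 * ∑ e ∈ insert (0 : Site 2) unitSteps, |dWaveFormFactor e / Real.sqrt 2|) ^ 2 *
            (L : ℝ) ^ 3) =
      (L : ℝ) ^ 2 * dWaveSourceEnergyDensityTT' tp U μ h₀ +
          4 * (-(-dWaveSourceEnergyObsTT' tp U μ h₀).groundEnergy -
            (dWaveSourceEnergyObsTT' tp U μ h₀).groundEnergy) * L -
        g * (L : ℝ) ^ 2 * (((L : ℂ) ^ 4)⁻¹ * ∑ x ∈ halfOpenBox 2 L, ∑ y ∈ halfOpenBox 2 L,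
          ω.dWavePairCorr x y).re +
        g * (16 * (2 * ∑ e ∈ insert (0 : Site 2) unitSteps, |dWaveFormFactor e / Real.sqrt 2|) ^ 2) * L := by
    field_simp
    ring
  rw [e] at key
  exact key

/-- **`TIGroundStatePairLROCeiling` HOLDS** (Koma–Tasaki 1993 Thm 7.3 in the infinite-volume
translation-invariant class, via Bogoliubov Jr.'s approximating Hamiltonian for the BCS crutch): for every
`h ≥ 0`, every translation-invariant ground state `ω` of `Ψ_h = hubbardTTPrimeSourcedInteraction 1 t' U μ
dWaveFormFactor h` and every `ε > 0`, eventually in `N`,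
`Re N⁻⁴ Σ_{x,y∈[0,N)²} ω(P_x^d⋆ P_y^d) ≤ (∂⁺E(h)/2)²  + ε`. Composition of the assembly
`tiGroundStatePairLROCeiling_of_boxTorusBound` ((ζ)(η), with (α)(β)(γ)(δ) inside `ahmTT'_sandwich`) and
`boxTorusBound` ((ε)). -/
theorem tiGroundStatePairLROCeiling_holds (tp U μ : ℝ) : TIGroundStatePairLROCeiling tp U μ :=
  tiGroundStatePairLROCeiling_of_boxTorusBound tp U μ (boxTorusBound tp U μ)

/-- **ZERO-FIELD CEILING, unconditional**: every translation-invariant ground state of the grand-canonical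
`t–t'` Hubbard interaction has asymptotic box pair LRO at most `(m⋆)²`
(`zeroFieldPairLROCeiling_of_ceiling` fed). Koma–Tasaki (1993) Thm 7.3. -/
theorem zeroFieldPairLROCeiling_holds (tp U μ : ℝ) : ZeroFieldPairLROCeiling tp U μ :=
  zeroFieldPairLROCeiling_of_ceiling (tiGroundStatePairLROCeiling_holds tp U μ)

/-- **THE SHARP INFINITE-VOLUME KOMA–TASAKI IDENTITY, unconditional**: `(m⋆)²` bounds the asymptotic box
pair LRO of EVERY translation-invariant ground state of the grand-canonical `t–t'` Hubbard interaction from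
above, and is attained uniformly in the box by a GAUGE-INVARIANT one — `max_ω limsup_N boxLRO_N(ω) = (m⋆)²`:
response ⇔ LRO with EQUALITY in the infinite-volume translation-invariant class
(`sharpKomaTasaki_of_ceiling` fed). Koma–Tasaki (1993) Thm 7.3; Kennedy–Lieb–Shastry (1988). -/
theorem sharpKomaTasaki (tp U μ : ℝ) :
    ZeroFieldPairLROCeiling tp U μ ∧
      ∃ ω : InfVolFermionState 2, ω.IsMeanEnergyMinimiser (hubbardTTPrimeMuInteraction 1 tp U μ) 1 ∧
        ω.IsGaugeInvariant ∧ ∀ N : ℕ, N ≠ 0 → dWaveOrderParameterTT' tp U μ ^ 2 ≤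
          (((N : ℂ) ^ 4)⁻¹ * ∑ x ∈ halfOpenBox 2 N, ∑ y ∈ halfOpenBox 2 N, ω.dWavePairCorr x y).re :=
  sharpKomaTasaki_of_ceiling (tiGroundStatePairLROCeiling_holds tp U μ)

/-- **`k = 0` CLUSTERING OF EVERY TRANSLATION-INVARIANT SOURCED GROUND STATE, unconditional**: at a source
`h > 0` where `E` has derivative `e'`, every ground state `ω` of `Ψ_h` has REAL pair amplitude
`ω(P₀^d) = −e'/2` and `boxLRO_N(ω) → (e'/2)²` — the finite-`h` pair-LRO word is the response word squared
(transplant-1's BN-T5; `clustering_of_ceiling` fed). Griffiths (1966) §II; Koma–Tasaki (1993) Thm 7.3. -/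
theorem clustering {tp U μ h : ℝ} (hh : 0 < h) {e' : ℝ}
    (hd : HasDerivAt (dWaveSourceEnergyDensityTT' tp U μ) e' h) {ω : InfVolFermionState 2}
    (hω : ω.IsMeanEnergyMinimiser (hubbardTTPrimeSourcedInteraction 1 tp U μ dWaveFormFactor h) 1) :
    ω.expect (pairRegion (insert (0 : Site 2) unitSteps) 0)
        (localPairAt (insert 0 unitSteps) dWaveFormFactor 0) = ((-e' / 2 : ℝ) : ℂ) ∧
      ∀ ε : ℝ, 0 < ε → ∀ᶠ N : ℕ in atTop,
        |(((N : ℂ) ^ 4)⁻¹ * ∑ x ∈ halfOpenBox 2 N, ∑ y ∈ halfOpenBox 2 N, ω.dWavePairCorr x y).re -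
          (e' / 2) ^ 2| ≤ ε :=
  clustering_of_ceiling (tiGroundStatePairLROCeiling_holds tp U μ) hh hd hω

end Summit.Ventures.CertifiedManyBodySolver.Observables.SourcedTorusAHM

end
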